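import Mathlib
import HarnessLib

/-!
# Picard mappings, Bessaga mappings and Maia's fixed point theorem

Source: V. Berinde, *Iterative Approximation of Fixed Points*, 2nd ed., Lecture Notes in
Mathematics 1912, Springer (2007) [Berinde2007], Chapter 2: §2.1 Definition 2.1 (Picard
mapping) and Example 2.1 (p. 34), §2.7 Remark 3 after Theorem 2.11 (weakly Picard operators,
p. 47), and §2.4 "Maia's fixed point theorem" (pp. 38–39): Definition 2.2 (Bessaga mapping, (17)),
Example 2.6 (every Picard mapping is a Bessaga mapping), Example 2.7 (= Exercise 1.13: a linear
map of `ℝ²` which is not a Euclidean contraction but a `9/10`-contraction for the metric `δ`),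
Theorem 2.6 (Maia's theorem, with its proof) and the Remarks after it: 1) the weakenings (i′),
(i″) of hypothesis (i), and 2) the Kannan variant of hypothesis (iv).

Let `(X, d)` be a metric space and `T : X → X`.

* Definition 2.1: `T` is a *Picard mapping* if `F_T = {x*}` and `Tⁿx₀ → x*` for every `x₀`
  (`IsPicardMapping`); `T` is *weakly Picard* if every Picard sequence converges to a fixed point
  (`IsWeaklyPicardMapping`).  Example 2.1: a contraction of a complete metric space is a Picard
  mapping (`IsPicardMapping.of_contractingWith`, from Mathlib's Banach theorem).  Corollary 2.1:
  the local form on a ball `B̄(y₀, r)` with `d(Ty₀, y₀) ≤ (1 - a) r`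
  (`local_contraction_principle`).
* Definition 2.2: `T` is a *Bessaga mapping* if there is `x*` with `F_{Tⁿ} = {x*}` for all `n ≥ 1`
  (`IsBessagaMapping`).  Example 2.6: a Picard mapping is a Bessaga mapping
  (`IsPicardMapping.isBessagaMapping`).
* Theorem 2.6 (Maia): `X` a set with two metrics `d`, `ρ`; if (i) `d ≤ ρ`, (ii) `(X, d)` is
  complete, (iii) `T` is `d`-continuous and (iv) `T` is an `a`-contraction for `ρ`, `a ∈ [0, 1)`,
  then `T` is a Picard mapping (`maia`), and the Picard iteration satisfies the a priori estimate
  `d(Tⁿx₀, x*) ≤ aⁿ/(1 - a) · ρ(x₀, Tx₀)` inherited from `(X, ρ)` (`maia_estimate`).  Remark 1):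
  (i) may be replaced by (i′) `d ≤ c ρ` (`maia_of_dist_le_mul`) or by (i″) `d(Tx, Ty) ≤ c ρ(x, y)`
  (`maia_of_dist_map_le`, the form from which the others are derived here).  Remark 2): (iv) may
  be replaced by "`T` is a Kannan mapping for `ρ`" (`maia_kannan`).
* Example 2.7 / Exercise 1.13: `T(x, y) = ((8x + 8y)/10, (x + y)/10)` satisfies
  `δ(Tu, Tv) ≤ 9/10 · δ(u, v)` for the metric `δ(u, v) = |u₁ - v₁| + |u₂ - v₂|` and is not a
  contraction (not even nonexpansive) for the Euclidean metric (`example27_l1_contraction`,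
  `example27_not_euclidean_contraction`).

Deviations from the source (declared).  (a) The second metric `ρ` is an arbitrary function
`ρ : X → X → ℝ` of which only `ρ(x, x) = 0`, `ρ ≥ 0` and the triangle inequality are assumed (no
symmetry, no separation) — this is all the proof of Theorem 2.6 uses; `d` is the instance metric.
(b) In (17) we require `n ≥ 1` (`F_{T⁰} = X`).  (c) Definition 2.1 is stated over any topological
space (Berinde assumes `(X, d)` complete); Example 2.6 needs unique limits (`T2Space`).  (d) The
constant `a` of (iv) may vanish and the constants `c` of (i′), (i″) are taken `≥ 0`.  (e) Bessaga's
converse of the contraction principle (Theorem 2.5) is not formalised here.  (f) Corollary 2.1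
is stated for a total `T` contracting on a closed ball `B̄(y₀, r)` with `d(Ty₀, y₀) ≤ (1 - a) r`
(the invariance the source actually proves), not for `T : B(y₀, R) → X`.
-/

open Filter Topology Function Set Metric

namespace Literature.Analysis.Convex.MaiaFixedPoint

variable {X : Type*}

/-! ## Picard and weakly Picard mappings (Definition 2.1) -/

/-- Definition 2.1: `T` is a *(strict) Picard mapping* if it has exactly one fixed point `x*` and
every Picard sequence `Tⁿx₀` converges to `x*`. [cite: Berinde2007, Ch. 2 §2.1 Def. 2.1] -/
def IsPicardMapping [TopologicalSpace X] (T : X → X) : Prop :=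
  ∃ p : X, T p = p ∧ (∀ q : X, T q = q → q = p) ∧
    ∀ x : X, Tendsto (fun n : ℕ => T^[n] x) atTop (𝓝 p)

/-- A *weakly Picard* mapping: every Picard sequence `Tⁿx₀` converges, and its limit is a fixed
point of `T` (the fixed point may depend on `x₀`).
[cite: Berinde2007, Ch. 2 §2.7 Remark 3 after Thm. 2.11 (with §2.1 Def. 2.1)] -/
def IsWeaklyPicardMapping [TopologicalSpace X] (T : X → X) : Prop :=
  ∀ x : X, ∃ p : X, T p = p ∧ Tendsto (fun n : ℕ => T^[n] x) atTop (𝓝 p)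

namespace IsPicardMapping

/-- A Picard mapping is weakly Picard. [cite: Berinde2007, Ch. 2 §2.7 Remark 3 after Thm. 2.11] -/
theorem isWeaklyPicardMapping [TopologicalSpace X] {T : X → X} (h : IsPicardMapping T) :
    IsWeaklyPicardMapping T := by
  obtain ⟨p, hp, -, ht⟩ := h
  exact fun x => ⟨p, hp, ht x⟩

/-- The fixed point of a Picard mapping is unique: any two fixed points coincide.
[cite: Berinde2007, Ch. 2 §2.1 Def. 2.1] -/
theorem fixedPoint_unique [TopologicalSpace X] {T : X → X} (h : IsPicardMapping T) {p q : X}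
    (hp : T p = p) (hq : T q = q) : p = q := by
  obtain ⟨r, -, huniq, -⟩ := h
  rw [huniq p hp, huniq q hq]

/-- For a Picard mapping, every Picard sequence converges to any given fixed point.
[cite: Berinde2007, Ch. 2 §2.1 Def. 2.1] -/
theorem tendsto_iterate [TopologicalSpace X] {T : X → X} (h : IsPicardMapping T) {p : X}
    (hp : T p = p) (x : X) : Tendsto (fun n : ℕ => T^[n] x) atTop (𝓝 p) := by
  obtain ⟨r, -, huniq, ht⟩ := h
  rw [huniq p hp]
  exact ht x

/-- Example 2.1: on a (nonempty) complete metric space every contraction is a Picard mapping —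
the contraction mapping principle, Theorem 2.1 (Mathlib's `ContractingWith`).
[cite: Berinde2007, Ch. 2 §2.1 Example 2.1] -/
theorem of_contractingWith [MetricSpace X] [CompleteSpace X] [Nonempty X] {T : X → X}
    {K : NNReal} (hT : ContractingWith K T) : IsPicardMapping T :=
  ⟨ContractingWith.fixedPoint T hT, hT.fixedPoint_isFixedPt,
    fun _ hq => hT.fixedPoint_unique hq, fun x => hT.tendsto_iterate_fixedPoint x⟩

end IsPicardMapping

/-- Corollary 2.1 (local form of the contraction mapping principle): if `T` is an
`a`-contraction on the closed ball `B̄(y₀, r)` of a complete metric space and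
`d(Ty₀, y₀) ≤ (1 - a) r`, then `B̄(y₀, r)` is `T`-invariant, `T` has exactly one fixed point in
`B̄(y₀, r)`, and the Picard iteration converges to it from any `x₀ ∈ B̄(y₀, r)`.  (Berinde states
it for `T` defined on the open ball `B(y₀, R)` with `d(Ty₀, y₀) < (1 - a)R` and proves exactly this
invariance of the closed balls; here `T` is total and the contraction condition is assumed on
the closed ball only.) [cite: Berinde2007, Ch. 2 §2.1 Cor. 2.1] -/
theorem local_contraction_principle [MetricSpace X] [CompleteSpace X] {T : X → X} {y₀ : X}
    {r a : ℝ} (ha0 : 0 ≤ a) (ha1 : a < 1)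
    (hT : ∀ x ∈ closedBall y₀ r, ∀ y ∈ closedBall y₀ r, dist (T x) (T y) ≤ a * dist x y)
    (hy : dist (T y₀) y₀ ≤ (1 - a) * r) :
    MapsTo T (closedBall y₀ r) (closedBall y₀ r) ∧
      ∃ p ∈ closedBall y₀ r, T p = p ∧ (∀ q ∈ closedBall y₀ r, T q = q → q = p) ∧
        ∀ x ∈ closedBall y₀ r, Tendsto (fun n : ℕ => T^[n] x) atTop (𝓝 p) := by
  have hr : 0 ≤ r := by nlinarith [dist_nonneg (x := T y₀) (y := y₀)]
  have hy0 : y₀ ∈ closedBall y₀ r := mem_closedBall_self hr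
  have hmaps : MapsTo T (closedBall y₀ r) (closedBall y₀ r) := by
    intro x hx
    have hx' : dist x y₀ ≤ r := mem_closedBall.1 hx
    rw [mem_closedBall]
    calc dist (T x) y₀ ≤ dist (T x) (T y₀) + dist (T y₀) y₀ := dist_triangle _ _ _
      _ ≤ a * dist x y₀ + (1 - a) * r := add_le_add (hT x hx y₀ hy0) hy
      _ ≤ a * r + (1 - a) * r := by nlinarith
      _ = r := by ring
  have hK : LipschitzOnWith (Real.toNNReal a) T (closedBall y₀ r) :=
    LipschitzOnWith.of_dist_le_mul fun x hx y hy' => by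
      rw [Real.coe_toNNReal a ha0]; exact hT x hx y hy'
  have hcw : ContractingWith (Real.toNNReal a) (hmaps.restrict T _ _) :=
    ⟨Real.toNNReal_lt_one.2 ha1, hK.mapsToRestrict hmaps⟩
  have hsc : IsComplete (closedBall y₀ r) := isClosed_closedBall.isComplete
  obtain ⟨p, hps, hpfix, -, -⟩ := hcw.exists_fixedPoint' hsc hmaps hy0 (edist_ne_top _ _)
  have huniq : ∀ q ∈ closedBall y₀ r, T q = q → q = p := by
    intro q hq hTq
    have h1 : dist q p ≤ a * dist q p := by
      have h := hT q hq p hps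
      rwa [hTq, show T p = p from hpfix] at h
    have h2 : dist q p ≤ 0 := by nlinarith [dist_nonneg (x := q) (y := p)]
    exact dist_le_zero.1 h2
  refine ⟨hmaps, p, hps, hpfix, huniq, fun x hx => ?_⟩
  obtain ⟨p', hp's, hp'fix, hp't, -⟩ := hcw.exists_fixedPoint' hsc hmaps hx (edist_ne_top _ _)
  rwa [huniq p' hp's hp'fix] at hp't

/-! ## Bessaga mappings (Definition 2.2) and Example 2.6 -/

/-- Definition 2.2, (17): `T` is a *Bessaga mapping* if there is `x*` with `F_{Tⁿ} = {x*}` for all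
`n ≥ 1`, i.e. `x*` is the only periodic point of `T`.
[cite: Berinde2007, Ch. 2 §2.4 Def. 2.2 (17)] -/
def IsBessagaMapping (T : X → X) : Prop :=
  ∃ p : X, ∀ n : ℕ, 1 ≤ n → {x : X | T^[n] x = x} = {p}

namespace IsBessagaMapping

/-- (17) unfolded: `T` is a Bessaga mapping iff some fixed point `x*` of `T` is its only periodic
point. [cite: Berinde2007, Ch. 2 §2.4 Def. 2.2 (17)] -/
theorem iff_fixedPoint (T : X → X) : IsBessagaMapping T ↔
    ∃ p : X, T p = p ∧ ∀ (n : ℕ) (x : X), 1 ≤ n → T^[n] x = x → x = p := by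
  constructor
  · rintro ⟨p, hp⟩
    refine ⟨p, ?_, fun n x hn hx => ?_⟩
    · have h1 : p ∈ {x : X | T^[1] x = x} := by rw [hp 1 le_rfl]; exact mem_singleton p
      simpa using h1
    · have hx' : x ∈ {x : X | T^[n] x = x} := hx
      rw [hp n hn] at hx'
      exact hx'
  · rintro ⟨p, hp, huniq⟩
    refine ⟨p, fun n hn => ?_⟩
    ext x
    simp only [mem_setOf_eq, mem_singleton_iff]
    constructor
    · exact huniq n x hn
    · rintro rfl
      exact IsFixedPt.iterate hp n

/-- A Bessaga mapping has exactly one fixed point (the case `n = 1` of (17)).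
[cite: Berinde2007, Ch. 2 §2.4 Def. 2.2 (17)] -/
theorem existsUnique_fixedPoint {T : X → X} (h : IsBessagaMapping T) : ∃! p : X, T p = p := by
  obtain ⟨p, hp, huniq⟩ := (iff_fixedPoint T).1 h
  exact ⟨p, hp, fun q hq => huniq 1 q le_rfl (by simpa using hq)⟩

end IsBessagaMapping

/-- Example 2.6: every Picard mapping is a Bessaga mapping (a periodic point `x = Tⁿx` has the
constant subsequence `T^{nk}x = x` of its Picard sequence, which converges to `x*`, so `x = x*`).
[cite: Berinde2007, Ch. 2 §2.4 Example 2.6] -/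
theorem IsPicardMapping.isBessagaMapping [TopologicalSpace X] [T2Space X] {T : X → X}
    (h : IsPicardMapping T) : IsBessagaMapping T := by
  obtain ⟨p, hp, -, ht⟩ := h
  refine (IsBessagaMapping.iff_fixedPoint T).2 ⟨p, hp, fun n x hn hx => ?_⟩
  have hfix : IsFixedPt T^[n] x := hx
  have hsub : Tendsto (fun k : ℕ => T^[n * k] x) atTop (𝓝 p) := by
    refine (ht x).comp ?_
    exact tendsto_atTop_mono (fun k => Nat.le_mul_of_pos_left k hn) tendsto_id
  have hconst : (fun k : ℕ => T^[n * k] x) = fun _ => x := by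
    funext k
    rw [iterate_mul]
    exact hfix.iterate k
  rw [hconst] at hsub
  exact tendsto_nhds_unique tendsto_const_nhds hsub

/-! ## Chains controlled by a second "metric" `ρ`

Throughout, `ρ : X → X → ℝ` is only assumed to satisfy `ρ(x, x) = 0`, `ρ ≥ 0` and the triangle
inequality (deviation (a)). -/

section Rho

variable {ρ : X → X → ℝ}

/-- The Cauchy estimate of the proof of Theorem 2.1, in `(X, ρ)`: if consecutive terms satisfy
`ρ(uₖ, uₖ₊₁) ≤ C qᵏ` with `q ∈ [0, 1)`, then `ρ(uₙ, uₘ) ≤ C (qⁿ - qᵐ)/(1 - q)` for `n ≤ m`.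
[cite: Berinde2007, Ch. 2 §2.4 proof of Thm. 2.6 (via Thm. 2.1)] -/
theorem rho_chain_le (hρ0 : ∀ x, ρ x x = 0) (hρt : ∀ x y z, ρ x z ≤ ρ x y + ρ y z) {u : ℕ → X}
    {C q : ℝ} (hq1 : q < 1) (hstep : ∀ k, ρ (u k) (u (k + 1)) ≤ C * q ^ k) {n m : ℕ}
    (hnm : n ≤ m) : ρ (u n) (u m) ≤ C * (q ^ n - q ^ m) / (1 - q) := by
  induction m, hnm using Nat.le_induction with
  | base => simp [hρ0]
  | succ m hnm ih =>
    have h1q : (1 - q) ≠ 0 := ne_of_gt (sub_pos.2 hq1)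
    have hs : C * q ^ m = C * (q ^ m - q ^ (m + 1)) / (1 - q) := by
      rw [eq_div_iff h1q]; ring
    calc ρ (u n) (u (m + 1)) ≤ ρ (u n) (u m) + ρ (u m) (u (m + 1)) := hρt _ _ _
      _ ≤ C * (q ^ n - q ^ m) / (1 - q) + C * q ^ m := add_le_add ih (hstep m)
      _ = C * (q ^ n - q ^ (m + 1)) / (1 - q) := by rw [hs]; ring

/-- Consequently `ρ(uₙ, uₘ) ≤ C qⁿ/(1 - q)` for `n ≤ m` (estimate (38)/(3) of Theorem 2.1 in
`(X, ρ)`). [cite: Berinde2007, Ch. 2 §2.4 proof of Thm. 2.6 (via Thm. 2.1 (3))] -/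
theorem rho_chain_le' (hρ0 : ∀ x, ρ x x = 0) (hρt : ∀ x y z, ρ x z ≤ ρ x y + ρ y z) {u : ℕ → X}
    {C q : ℝ} (hC : 0 ≤ C) (hq0 : 0 ≤ q) (hq1 : q < 1)
    (hstep : ∀ k, ρ (u k) (u (k + 1)) ≤ C * q ^ k) {n m : ℕ} (hnm : n ≤ m) :
    ρ (u n) (u m) ≤ C * q ^ n / (1 - q) := by
  refine (rho_chain_le hρ0 hρt hq1 hstep hnm).trans ?_
  have h1q : 0 < 1 - q := sub_pos.2 hq1
  exact div_le_div_of_nonneg_right (by nlinarith [pow_nonneg hq0 m]) h1q.le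

/-- Hypothesis (iv) of Theorem 2.6 gives geometric `ρ`-steps along a Picard sequence:
`ρ(Tᵏx, Tᵏ⁺¹x) ≤ aᵏ ρ(x, Tx)`. [cite: Berinde2007, Ch. 2 §2.4 proof of Thm. 2.6] -/
theorem rho_iterate_succ_le {T : X → X} {a : ℝ} (ha0 : 0 ≤ a)
    (hcontr : ∀ x y, ρ (T x) (T y) ≤ a * ρ x y) (x : X) (k : ℕ) :
    ρ (T^[k] x) (T^[k + 1] x) ≤ ρ x (T x) * a ^ k := by
  induction k with
  | zero => simp
  | succ k ih =>
    calc ρ (T^[k + 1] x) (T^[k + 1 + 1] x) = ρ (T (T^[k] x)) (T (T^[k + 1] x)) := by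
          rw [iterate_succ_apply' T (k + 1), iterate_succ_apply' T k]
      _ ≤ a * ρ (T^[k] x) (T^[k + 1] x) := hcontr _ _
      _ ≤ a * (ρ x (T x) * a ^ k) := mul_le_mul_of_nonneg_left ih ha0
      _ = ρ x (T x) * a ^ (k + 1) := by ring

/-- The Kannan variant (Remark 2) after Theorem 2.6): if `ρ(Tx, Ty) ≤ b [ρ(x, Tx) + ρ(y, Ty)]`
with `b ∈ [0, 1/2)`, then `ρ(Tᵏx, Tᵏ⁺¹x) ≤ (b/(1 - b))ᵏ ρ(x, Tx)`.
[cite: Berinde2007, Ch. 2 §2.4 Remark 2 after Thm. 2.6 (via Thm. 2.3)] -/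
theorem rho_iterate_succ_le_kannan {T : X → X} {b : ℝ} (hb0 : 0 ≤ b) (hb : b < 1 / 2)
    (hK : ∀ x y, ρ (T x) (T y) ≤ b * (ρ x (T x) + ρ y (T y))) (x : X) (k : ℕ) :
    ρ (T^[k] x) (T^[k + 1] x) ≤ ρ x (T x) * (b / (1 - b)) ^ k := by
  have h1b : 0 < 1 - b := by linarith
  induction k with
  | zero => simp
  | succ k ih =>
    have hstep : ρ (T^[k + 1] x) (T^[k + 1 + 1] x) ≤
        b / (1 - b) * ρ (T^[k] x) (T^[k + 1] x) := by
      have h0 := hK (T^[k] x) (T^[k + 1] x)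
      rw [← iterate_succ_apply' T k x, ← iterate_succ_apply' T (k + 1) x] at h0
      rw [div_mul_eq_mul_div, le_div_iff₀ h1b]
      nlinarith [h0]
    calc ρ (T^[k + 1] x) (T^[k + 1 + 1] x) ≤ b / (1 - b) * ρ (T^[k] x) (T^[k + 1] x) := hstep
      _ ≤ b / (1 - b) * (ρ x (T x) * (b / (1 - b)) ^ k) :=
        mul_le_mul_of_nonneg_left ih (div_nonneg hb0 h1b.le)
      _ = ρ x (T x) * (b / (1 - b)) ^ (k + 1) := by ring

end Rho

/-! ## From `ρ`-estimates to `d`-convergence -/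

section Metric

variable [MetricSpace X]

/-- If `d(uₙ₊₁, uₘ₊₁) ≤ D qⁿ` for `n ≤ m` with `q ∈ [0, 1)`, then `(uₙ)` is `d`-Cauchy (the step
"(i) ⟹ Cauchy in `(X, d)`" of the proof of Theorem 2.6, in the form covering (i″)).
[cite: Berinde2007, Ch. 2 §2.4 proof of Thm. 2.6] -/
theorem cauchySeq_of_dist_succ_le {u : ℕ → X} {D q : ℝ} (hq0 : 0 ≤ q) (hq1 : q < 1)
    (hd : ∀ n m : ℕ, n ≤ m → dist (u (n + 1)) (u (m + 1)) ≤ D * q ^ n) : CauchySeq u := by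
  refine Metric.cauchySeq_iff'.2 fun ε hε => ?_
  have ht : Tendsto (fun n : ℕ => D * q ^ n) atTop (𝓝 0) := by
    have h := (tendsto_pow_atTop_nhds_zero_of_lt_one hq0 hq1).const_mul D
    rwa [mul_zero] at h
  obtain ⟨N, hN⟩ := eventually_atTop.1 (ht.eventually (gt_mem_nhds hε))
  refine ⟨N + 1, fun n hn => ?_⟩
  obtain ⟨n', rfl⟩ : ∃ n', n = n' + 1 := ⟨n - 1, by omega⟩
  rw [dist_comm]
  exact (hd N n' (by omega)).trans_lt (hN N le_rfl)

/-- … and the limit then satisfies `d(uₙ₊₁, p) ≤ D qⁿ`.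
[cite: Berinde2007, Ch. 2 §2.4 proof of Thm. 2.6 (via Thm. 2.1 (3))] -/
theorem dist_succ_lim_le {u : ℕ → X} {D q : ℝ}
    (hd : ∀ n m : ℕ, n ≤ m → dist (u (n + 1)) (u (m + 1)) ≤ D * q ^ n) {p : X}
    (hp : Tendsto u atTop (𝓝 p)) (n : ℕ) : dist (u (n + 1)) p ≤ D * q ^ n := by
  have h1 : Tendsto (fun m : ℕ => u (m + 1)) atTop (𝓝 p) := hp.comp (tendsto_add_atTop_nat 1)
  have ht : Tendsto (fun m : ℕ => dist (u (n + 1)) (u (m + 1))) atTop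
      (𝓝 (dist (u (n + 1)) p)) := tendsto_const_nhds.dist h1
  exact le_of_tendsto ht (eventually_atTop.2 ⟨n, fun m hm => hd n m hm⟩)

/-- Hypothesis (iii) at work: the limit of a convergent Picard sequence of a continuous map is a
fixed point. [cite: Berinde2007, Ch. 2 §2.4 proof of Thm. 2.6] -/
theorem isFixedPt_of_tendsto_iterate {T : X → X} (hT : Continuous T) {x p : X}
    (hp : Tendsto (fun n : ℕ => T^[n] x) atTop (𝓝 p)) : T p = p := by
  have h1 : Tendsto (fun n : ℕ => T^[n + 1] x) atTop (𝓝 p) := hp.comp (tendsto_add_atTop_nat 1)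
  have h2 : Tendsto (fun n : ℕ => T (T^[n] x)) atTop (𝓝 (T p)) := (hT.tendsto p).comp hp
  have h3 : (fun n : ℕ => T^[n + 1] x) = fun n : ℕ => T (T^[n] x) :=
    funext fun n => iterate_succ_apply' T n x
  rw [h3] at h1
  exact tendsto_nhds_unique h2 h1

variable {ρ : X → X → ℝ} {T : X → X}

/-- **Theorem 2.6 with Remark 1) (i″)** (Maia's theorem in the form of Rus): let `ρ` satisfy
`ρ(x, x) = 0`, `ρ ≥ 0` and the triangle inequality; assume (i″) `d(Tx, Ty) ≤ c ρ(x, y)` with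
`c ≥ 0`, (ii) `(X, d)` complete, (iii) `T` continuous for `d`, (iv) `ρ(Tx, Ty) ≤ a ρ(x, y)` with
`a ∈ [0, 1)`.  Then for every `x₀` the Picard sequence converges in `(X, d)` to a fixed point
`p` of `T`, fixed points are unique, and `d(Tⁿ⁺¹x₀, p) ≤ c · aⁿ/(1 - a) · ρ(x₀, Tx₀)`.
[cite: Berinde2007, Ch. 2 §2.4 Thm. 2.6 with Remark 1 (i″)] -/
theorem maia_of_dist_map_le [CompleteSpace X] (hρ0 : ∀ x, ρ x x = 0) (hρn : ∀ x y, 0 ≤ ρ x y)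
    (hρt : ∀ x y z, ρ x z ≤ ρ x y + ρ y z) {c a : ℝ} (hc : 0 ≤ c)
    (hd : ∀ x y, dist (T x) (T y) ≤ c * ρ x y) (hT : Continuous T) (ha0 : 0 ≤ a) (ha1 : a < 1)
    (hcontr : ∀ x y, ρ (T x) (T y) ≤ a * ρ x y) (x : X) :
    ∃ p : X, T p = p ∧ (∀ q, T q = q → q = p) ∧ Tendsto (fun n : ℕ => T^[n] x) atTop (𝓝 p) ∧
      ∀ n : ℕ, dist (T^[n + 1] x) p ≤ c * (ρ x (T x) / (1 - a)) * a ^ n := by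
  have hchain : ∀ n m : ℕ, n ≤ m → ρ (T^[n] x) (T^[m] x) ≤ ρ x (T x) * a ^ n / (1 - a) :=
    fun n m hnm => rho_chain_le' hρ0 hρt (hρn _ _) ha0 ha1 (rho_iterate_succ_le ha0 hcontr x) hnm
  have hdist : ∀ n m : ℕ, n ≤ m →
      dist (T^[n + 1] x) (T^[m + 1] x) ≤ c * (ρ x (T x) / (1 - a)) * a ^ n := by
    intro n m hnm
    rw [iterate_succ_apply', iterate_succ_apply']
    calc dist (T (T^[n] x)) (T (T^[m] x)) ≤ c * ρ (T^[n] x) (T^[m] x) := hd _ _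
      _ ≤ c * (ρ x (T x) * a ^ n / (1 - a)) := mul_le_mul_of_nonneg_left (hchain n m hnm) hc
      _ = c * (ρ x (T x) / (1 - a)) * a ^ n := by ring
  obtain ⟨p, hp⟩ := cauchySeq_tendsto_of_complete
    (cauchySeq_of_dist_succ_le (u := fun n => T^[n] x) ha0 ha1 hdist)
  have hfix : T p = p := isFixedPt_of_tendsto_iterate hT hp
  refine ⟨p, hfix, fun q hq => ?_, hp, fun n => dist_succ_lim_le (u := fun n => T^[n] x) hdist hp n⟩
  -- uniqueness: `ρ(q, p) = ρ(Tq, Tp) ≤ a ρ(q, p)` forces `ρ(q, p) = 0`, then (i″) gives `d = 0`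
  have h1 : ρ q p ≤ a * ρ q p := by simpa [hq, hfix] using hcontr q p
  have h2 : ρ q p = 0 := le_antisymm (by nlinarith [hρn q p]) (hρn q p)
  have h3 : dist q p ≤ 0 := by simpa [hq, hfix, h2] using hd q p
  exact dist_le_zero.1 h3

/-- **Theorem 2.6** (Maia, 1968): `X` with two metrics `d` (the instance) and `ρ` (deviation (a));
(i) `d(x, y) ≤ ρ(x, y)`, (ii) `(X, d)` complete, (iii) `T` continuous for `d`, (iv) `T` an
`a`-contraction for `ρ`, `a ∈ [0, 1)`.  Then `T` is a Picard mapping.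
[cite: Berinde2007, Ch. 2 §2.4 Thm. 2.6] -/
theorem maia [CompleteSpace X] [Nonempty X] (hρ0 : ∀ x, ρ x x = 0) (hρn : ∀ x y, 0 ≤ ρ x y)
    (hρt : ∀ x y z, ρ x z ≤ ρ x y + ρ y z) (hdρ : ∀ x y, dist x y ≤ ρ x y) (hT : Continuous T)
    {a : ℝ} (ha0 : 0 ≤ a) (ha1 : a < 1) (hcontr : ∀ x y, ρ (T x) (T y) ≤ a * ρ x y) :
    IsPicardMapping T := by
  have hd : ∀ x y, dist (T x) (T y) ≤ a * ρ x y :=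
    fun x y => (hdρ _ _).trans (hcontr x y)
  obtain ⟨p, hp, huniq, -, -⟩ :=
    maia_of_dist_map_le hρ0 hρn hρt ha0 hd hT ha0 ha1 hcontr (Classical.arbitrary X)
  refine ⟨p, hp, huniq, fun x => ?_⟩
  obtain ⟨p', hp', -, ht, -⟩ := maia_of_dist_map_le hρ0 hρn hρt ha0 hd hT ha0 ha1 hcontr x
  rwa [huniq p' hp'] at ht

/-- Theorem 2.6, a priori estimate inherited from `(X, ρ)`: under the hypotheses of Maia's
theorem, for the fixed point `x*`, `d(Tⁿx₀, x*) ≤ aⁿ/(1 - a) · ρ(x₀, Tx₀)` (estimate (3) of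
Theorem 2.1 in `(X, ρ)`, read in `(X, d)` through (i)).
[cite: Berinde2007, Ch. 2 §2.4 Thm. 2.6 (proof, via Thm. 2.1 (3))] -/
theorem maia_estimate [CompleteSpace X] (hρ0 : ∀ x, ρ x x = 0) (hρn : ∀ x y, 0 ≤ ρ x y)
    (hρt : ∀ x y z, ρ x z ≤ ρ x y + ρ y z) (hdρ : ∀ x y, dist x y ≤ ρ x y) (hT : Continuous T)
    {a : ℝ} (ha0 : 0 ≤ a) (ha1 : a < 1) (hcontr : ∀ x y, ρ (T x) (T y) ≤ a * ρ x y) {p : X}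
    (hp : T p = p) (x : X) (n : ℕ) : dist (T^[n] x) p ≤ a ^ n / (1 - a) * ρ x (T x) := by
  have hd : ∀ x y, dist (T x) (T y) ≤ a * ρ x y :=
    fun x y => (hdρ _ _).trans (hcontr x y)
  obtain ⟨p', hp', huniq, ht, -⟩ := maia_of_dist_map_le hρ0 hρn hρt ha0 hd hT ha0 ha1 hcontr x
  have hpp : p = p' := huniq p hp
  subst hpp
  have hchain : ∀ k m : ℕ, k ≤ m → ρ (T^[k] x) (T^[m] x) ≤ ρ x (T x) * a ^ k / (1 - a) :=
    fun k m hkm => rho_chain_le' hρ0 hρt (hρn _ _) ha0 ha1 (rho_iterate_succ_le ha0 hcontr x) hkm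
  have hlim : Tendsto (fun m : ℕ => dist (T^[n] x) (T^[m] x)) atTop (𝓝 (dist (T^[n] x) p)) :=
    tendsto_const_nhds.dist ht
  refine le_of_tendsto hlim (eventually_atTop.2 ⟨n, fun m hm => ?_⟩)
  calc dist (T^[n] x) (T^[m] x) ≤ ρ (T^[n] x) (T^[m] x) := hdρ _ _
    _ ≤ ρ x (T x) * a ^ n / (1 - a) := hchain n m hm
    _ = a ^ n / (1 - a) * ρ x (T x) := by ring

/-- **Theorem 2.6 with Remark 1) (i′)**: hypothesis (i) may be weakened to
`d(x, y) ≤ c ρ(x, y)` for some `c ≥ 0`. [cite: Berinde2007, Ch. 2 §2.4 Thm. 2.6 Remark 1 (i′)] -/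
theorem maia_of_dist_le_mul [CompleteSpace X] [Nonempty X] (hρ0 : ∀ x, ρ x x = 0)
    (hρn : ∀ x y, 0 ≤ ρ x y) (hρt : ∀ x y z, ρ x z ≤ ρ x y + ρ y z) {c : ℝ} (hc : 0 ≤ c)
    (hdρ : ∀ x y, dist x y ≤ c * ρ x y) (hT : Continuous T) {a : ℝ} (ha0 : 0 ≤ a) (ha1 : a < 1)
    (hcontr : ∀ x y, ρ (T x) (T y) ≤ a * ρ x y) : IsPicardMapping T := by
  have hd : ∀ x y, dist (T x) (T y) ≤ c * a * ρ x y := fun x y =>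
    calc dist (T x) (T y) ≤ c * ρ (T x) (T y) := hdρ _ _
      _ ≤ c * (a * ρ x y) := mul_le_mul_of_nonneg_left (hcontr x y) hc
      _ = c * a * ρ x y := by ring
  have hca : 0 ≤ c * a := mul_nonneg hc ha0
  obtain ⟨p, hp, huniq, -, -⟩ :=
    maia_of_dist_map_le hρ0 hρn hρt hca hd hT ha0 ha1 hcontr (Classical.arbitrary X)
  refine ⟨p, hp, huniq, fun x => ?_⟩
  obtain ⟨p', hp', -, ht, -⟩ := maia_of_dist_map_le hρ0 hρn hρt hca hd hT ha0 ha1 hcontr x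
  rwa [huniq p' hp'] at ht

/-- **Theorem 2.6 with Remark 1) (i″)**, packaged: with (i″) `d(Tx, Ty) ≤ c ρ(x, y)`, `c ≥ 0`, in
place of (i), `T` is a Picard mapping. [cite: Berinde2007, Ch. 2 §2.4 Thm. 2.6 Remark 1 (i″)] -/
theorem maia_of_dist_map_le' [CompleteSpace X] [Nonempty X] (hρ0 : ∀ x, ρ x x = 0)
    (hρn : ∀ x y, 0 ≤ ρ x y) (hρt : ∀ x y z, ρ x z ≤ ρ x y + ρ y z) {c : ℝ} (hc : 0 ≤ c)
    (hd : ∀ x y, dist (T x) (T y) ≤ c * ρ x y) (hT : Continuous T) {a : ℝ} (ha0 : 0 ≤ a)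
    (ha1 : a < 1) (hcontr : ∀ x y, ρ (T x) (T y) ≤ a * ρ x y) : IsPicardMapping T := by
  obtain ⟨p, hp, huniq, -, -⟩ :=
    maia_of_dist_map_le hρ0 hρn hρt hc hd hT ha0 ha1 hcontr (Classical.arbitrary X)
  refine ⟨p, hp, huniq, fun x => ?_⟩
  obtain ⟨p', hp', -, ht, -⟩ := maia_of_dist_map_le hρ0 hρn hρt hc hd hT ha0 ha1 hcontr x
  rwa [huniq p' hp'] at ht

/-- **Theorem 2.6 with Remark 2)** (Kannan variant): hypothesis (iv) may be replaced by
"`T : (X, ρ) → (X, ρ)` is a Kannan mapping", `ρ(Tx, Ty) ≤ b [ρ(x, Tx) + ρ(y, Ty)]` with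
`b ∈ [0, 1/2)`; then (with (i), (ii), (iii)) `T` is a Picard mapping.
[cite: Berinde2007, Ch. 2 §2.4 Thm. 2.6 Remark 2] -/
theorem maia_kannan [CompleteSpace X] [Nonempty X] (hρ0 : ∀ x, ρ x x = 0)
    (hρn : ∀ x y, 0 ≤ ρ x y) (hρt : ∀ x y z, ρ x z ≤ ρ x y + ρ y z)
    (hdρ : ∀ x y, dist x y ≤ ρ x y) (hT : Continuous T) {b : ℝ} (hb0 : 0 ≤ b) (hb : b < 1 / 2)
    (hK : ∀ x y, ρ (T x) (T y) ≤ b * (ρ x (T x) + ρ y (T y))) : IsPicardMapping T := by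
  have h1b : 0 < 1 - b := by linarith
  set q : ℝ := b / (1 - b) with hq
  have hq0 : 0 ≤ q := div_nonneg hb0 h1b.le
  have hq1 : q < 1 := by rw [hq, div_lt_one h1b]; linarith
  -- convergence of every Picard sequence to a fixed point
  have hconv : ∀ x : X, ∃ p : X, T p = p ∧ Tendsto (fun n : ℕ => T^[n] x) atTop (𝓝 p) := by
    intro x
    have hchain : ∀ n m : ℕ, n ≤ m → ρ (T^[n] x) (T^[m] x) ≤ ρ x (T x) * q ^ n / (1 - q) :=
      fun n m hnm => rho_chain_le' hρ0 hρt (hρn _ _) hq0 hq1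
        (rho_iterate_succ_le_kannan hb0 hb hK x) hnm
    have hdist : ∀ n m : ℕ, n ≤ m →
        dist (T^[n + 1] x) (T^[m + 1] x) ≤ (ρ x (T x) * q / (1 - q)) * q ^ n := by
      intro n m hnm
      calc dist (T^[n + 1] x) (T^[m + 1] x) ≤ ρ (T^[n + 1] x) (T^[m + 1] x) := hdρ _ _
        _ ≤ ρ x (T x) * q ^ (n + 1) / (1 - q) := hchain (n + 1) (m + 1) (by omega)
        _ = (ρ x (T x) * q / (1 - q)) * q ^ n := by ring
    obtain ⟨p, hp⟩ := cauchySeq_tendsto_of_complete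
      (cauchySeq_of_dist_succ_le (u := fun n => T^[n] x) hq0 hq1 hdist)
    exact ⟨p, isFixedPt_of_tendsto_iterate hT hp, hp⟩
  -- uniqueness of the fixed point: `ρ(p, q) = ρ(Tp, Tq) ≤ b [ρ(p, Tp) + ρ(q, Tq)] = 0`
  have huniq : ∀ p p' : X, T p = p → T p' = p' → p' = p := by
    intro p p' hp hp'
    have h1 : ρ p' p ≤ 0 := by simpa [hp, hp', hρ0] using hK p' p
    have h2 : dist p' p ≤ 0 := (hdρ _ _).trans h1
    exact dist_le_zero.1 h2
  obtain ⟨p, hp, -⟩ := hconv (Classical.arbitrary X)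
  refine ⟨p, hp, fun q' hq' => huniq p q' hp hq', fun x => ?_⟩
  obtain ⟨p', hp', ht⟩ := hconv x
  rwa [huniq p p' hp hp'] at ht

end Metric

/-! ## Example 2.7 (= Exercise 1.13) -/

section Example27

/-- The linear map of Example 2.7 / Exercise 1.13, `T(x, y) = ((8x + 8y)/10, (x + y)/10)`.
[cite: Berinde2007, Ch. 2 §2.4 Example 2.7] -/
noncomputable def example27Map (u : ℝ × ℝ) : ℝ × ℝ := ((8 * u.1 + 8 * u.2) / 10, (u.1 + u.2) / 10)

/-- The metric `δ(u, v) = |u₁ - v₁| + |u₂ - v₂|` of Example 1.3 2) on `ℝ²`.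
[cite: Berinde2007, Ch. 2 §2.4 Example 2.7 (with Ch. 1 Example 1.3 2))] -/
noncomputable def deltaDist (u v : ℝ × ℝ) : ℝ := |u.1 - v.1| + |u.2 - v.2|

/-- Example 2.7 (b) / Exercise 1.13 (b): `T` is a `9/10`-contraction for `δ`:
`δ(Tu, Tv) = 9/10 · |(u₁ + u₂) - (v₁ + v₂)| ≤ 9/10 · δ(u, v)`.
[cite: Berinde2007, Ch. 2 §2.4 Example 2.7] -/
theorem example27_l1_contraction (u v : ℝ × ℝ) :
    deltaDist (example27Map u) (example27Map v) ≤ 9 / 10 * deltaDist u v := by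
  simp only [deltaDist, example27Map]
  have h1 : |(8 * u.1 + 8 * u.2) / 10 - (8 * v.1 + 8 * v.2) / 10| =
      8 / 10 * |(u.1 - v.1) + (u.2 - v.2)| := by
    rw [show (8 * u.1 + 8 * u.2) / 10 - (8 * v.1 + 8 * v.2) / 10 =
      8 / 10 * ((u.1 - v.1) + (u.2 - v.2)) by ring, abs_mul,
      abs_of_pos (by norm_num : (0:ℝ) < 8 / 10)]
  have h2 : |(u.1 + u.2) / 10 - (v.1 + v.2) / 10| = 1 / 10 * |(u.1 - v.1) + (u.2 - v.2)| := by
    rw [show (u.1 + u.2) / 10 - (v.1 + v.2) / 10 = 1 / 10 * ((u.1 - v.1) + (u.2 - v.2)) by ring,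
      abs_mul, abs_of_pos (by norm_num : (0:ℝ) < 1 / 10)]
  rw [h1, h2]
  have h3 : |(u.1 - v.1) + (u.2 - v.2)| ≤ |u.1 - v.1| + |u.2 - v.2| := abs_add_le _ _
  linarith

/-- Example 2.7 (a) / Exercise 1.13 (a): `T` is not a contraction for the Euclidean metric — it
is not even nonexpansive: for `u = (1, 1)`, `v = (0, 0)` one has
`‖Tu - Tv‖₂² = (16/10)² + (2/10)² = 2.6 > 2 = ‖u - v‖₂²`, so no `a ∈ [0, 1)` with
`‖Tu - Tv‖₂ ≤ a ‖u - v‖₂` exists (stated with squared Euclidean distances on `ℝ × ℝ`).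
[cite: Berinde2007, Ch. 2 §2.4 Example 2.7] -/
theorem example27_not_euclidean_contraction :
    ¬ ∃ a : ℝ, 0 ≤ a ∧ a < 1 ∧ ∀ u v : ℝ × ℝ,
      ((example27Map u).1 - (example27Map v).1) ^ 2
          + ((example27Map u).2 - (example27Map v).2) ^ 2
        ≤ a ^ 2 * ((u.1 - v.1) ^ 2 + (u.2 - v.2) ^ 2) := by
  rintro ⟨a, ha0, ha1, h⟩
  have h0 := h (1, 1) (0, 0)
  simp only [example27Map] at h0
  norm_num at h0
  nlinarith [mul_nonneg ha0 (sub_nonneg.2 ha1.le)]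

end Example27

end Literature.Analysis.Convex.MaiaFixedPoint
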